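import Summits.Parity.GeneralizedHardyLittlewood.Theses.LiouvilleShiftedTables

/-!
# Sketch — crux stmt-Parity-14271 (`DilatedTableChowla`), ideator 3, round 1

First lemmas of the two idea cards, stated over existing declarations (sorry-free: `Prop`
definitions plus a few checked trivialities). Namespace as the CRUX PROTOCOL prescribes.
-/

namespace Summit.Parity.GeneralizedHardyLittlewood.Cruxes.DilatedTableChowla.Sketch

open scoped BigOperators
open Finset Real ArithmeticFunction
open Summit.Parity.GeneralizedHardyLittlewood.Theses.LiouvilleShiftedTables

/-- The `(q;u,v)`-block fourth moment of the crux, verbatim the summand of `DilatedTableChowla`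
without the weight `q³`: `F_c(q,u,v; A, x) = Σ_{a,a' ∼ A, a≡a'≡u (q)} (Σ_{b ≤ x/A, b≡v (q)} λ(ab+c)λ(a'b+c))²`. -/
noncomputable def blockMoment (c : ℤ) (x A : ℝ) (q u v : ℕ) : ℝ :=
  ∑ a ∈ (Finset.Ioc ⌊A⌋₊ ⌊2 * A⌋₊).filter (fun a : ℕ => a ≡ u [MOD q]),
    ∑ a' ∈ (Finset.Ioc ⌊A⌋₊ ⌊2 * A⌋₊).filter (fun a' : ℕ => a' ≡ u [MOD q]),
      (∑ b ∈ (Finset.Icc 1 ⌊x / A⌋₊).filter (fun b : ℕ => b ≡ v [MOD q]),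
        (liouville (Int.toNat ((a : ℤ) * b + c)) : ℝ) *
          (liouville (Int.toNat ((a' : ℤ) * b + c)) : ℝ)) ^ 2

/-- The undilated table moment (the summand of `TableChowla`). -/
noncomputable def tableMoment (c : ℤ) (x A : ℝ) : ℝ :=
  ∑ a ∈ Finset.Ioc ⌊A⌋₊ ⌊2 * A⌋₊, ∑ a' ∈ Finset.Ioc ⌊A⌋₊ ⌊2 * A⌋₊,
    (∑ b ∈ Finset.Icc 1 ⌊x / A⌋₊,
      (liouville (Int.toNat ((a : ℤ) * b + c)) : ℝ) *
        (liouville (Int.toNat ((a' : ℤ) * b + c)) : ℝ)) ^ 2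

/-! ## Card `positivity-quarantine` -/

/-- FIRST LEMMA (P), abstract form: Gram fourth moments are monotone under enlarging the column
set (PSD order `M_T M_Tᵀ ≼ M_{T'} M_{T'}ᵀ` and `0 ≼ X ≼ Y ⇒ tr X² ≤ tr Y²`) — NOT termwise. Rows:
dropping rows drops non-negative terms. Pure linear algebra over any real array `f`. -/
def GramFourthMomentMonotone : Prop :=
  ∀ (f : ℕ → ℕ → ℝ) (S S' T T' : Finset ℕ), S ⊆ S' → T ⊆ T' →
    (∑ a ∈ S, ∑ a' ∈ S, (∑ b ∈ T, f a b * f a' b) ^ 2) ≤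
      ∑ a ∈ S', ∑ a' ∈ S', (∑ b ∈ T', f a b * f a' b) ^ 2

/-- Consequence for the crux: every block moment is at most the full table moment. -/
def BlockLeTable : Prop :=
  ∀ (c : ℤ) (x A : ℝ) (q u v : ℕ), blockMoment c x A q u v ≤ tableMoment c x A

/-- The row half of (P) is the trivial half: checked here for the diagonal-free shape we use
(a filtered double sum of non-negative terms is at most the unfiltered one). -/
example (g : ℕ → ℕ → ℝ) (hg : ∀ a a', 0 ≤ g a a') (S : Finset ℕ) (p : ℕ → Prop)
    [DecidablePred p] :
    (∑ a ∈ S.filter p, ∑ a' ∈ S.filter p, g a a') ≤ ∑ a ∈ S, ∑ a' ∈ S, g a a' := by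
  apply le_trans (Finset.sum_le_sum_of_subset_of_nonneg (Finset.filter_subset p S)
    (fun a _ _ => Finset.sum_nonneg (fun a' _ => hg a a')))
  apply Finset.sum_le_sum
  intro a _
  exact Finset.sum_le_sum_of_subset_of_nonneg (Finset.filter_subset p S) (fun a' _ _ => hg a a')

/-- SMALL DILATIONS FOR FREE: `TableChowla` (with exponent `C + 4K + 1`) gives the polylogarithmic
dilation range of the crux, class-sup included, by (P) alone:
`Σ_{q ≤ (log x)^K} q³ · sup_{u,v} F(q,u,v) ≤ (log x)^{4K} · tableMoment ≤ x²/(log x)^C`. -/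
def SmallDilations : Prop :=
  ∀ c : ℤ, c ≠ 0 → ∀ δ : ℝ, 0 < δ → δ ≤ 1 / 12 → ∀ K : ℝ, 0 < K → ∀ C : ℝ, 0 < C →
    ∃ x₀ : ℝ, ∀ x : ℝ, x₀ ≤ x → ∀ A : ℝ, x ^ δ ≤ A → A ≤ x ^ (1 / 3 + δ) → ∀ u v : ℕ → ℕ,
      (∑ q ∈ Finset.Icc 1 ⌊Real.log x ^ K⌋₊, (q : ℝ) ^ 3 * blockMoment c x A q (u q) (v q))
        ≤ x ^ 2 / Real.log x ^ C

/-- The implication the card claims is PROVABLE NOW (positivity + `TableChowla` at `C' = C+4K+1`). -/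
def SmallDilationsFromTable : Prop := GramFourthMomentMonotone → TableChowla → SmallDilations

/-- FIRST LEMMA (Q): harmonic quarantine. With the trivial block bound `F ≤ 16 x²/q⁴` (any
non-negative `F` will do), the multiples of a finite set `S` of moduli, each `≥ Lam`, contribute
`≤ 16 x² · |S| · (1 + log Q)/Lam` to the `ℓ¹`-dilation sum. Elementary (harmonic sums). -/
def HarmonicQuarantine : Prop :=
  ∀ (x Q Lam : ℝ) (S : Finset ℕ) (F : ℕ → ℝ), 1 ≤ Q → 1 ≤ Lam →
    (∀ s ∈ S, 1 ≤ s ∧ Lam ≤ (s : ℝ)) →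
    (∀ q : ℕ, 1 ≤ q → 0 ≤ F q ∧ F q ≤ 16 * x ^ 2 / (q : ℝ) ^ 4) →
    (∑ q ∈ (Finset.Icc 1 ⌊Q⌋₊).filter (fun q : ℕ => ∃ s ∈ S, s ∣ q), (q : ℝ) ^ 3 * F q)
      ≤ 16 * x ^ 2 * S.card * (1 + Real.log Q) / Lam

/-- Linnik-box genericity of a dilation `q` at scale `x` with width parameter `K'`: no Dirichlet
character whose modulus divides `q` has an `L`-zero in `σ > 1 − K' log log x / log x`,
`|t| ≤ x²` (complex characters included — they bias blocks through `χ(uv+c)` too). -/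
def LinnikGeneric (q : ℕ) (x K' : ℝ) : Prop :=
  ∀ (d : ℕ) [NeZero d], d ∣ q → ∀ χ : DirichletCharacter ℂ d, ∀ s : ℂ,
    1 - K' * Real.log (Real.log x) / Real.log x < s.re → |s.im| ≤ x ^ 2 → s ≠ 1 →
      DirichletCharacter.LFunction χ s ≠ 0

/-- TRANSFER `C⁺` of the card (the generic core that remains after (P) and (Q)): affine
`TableChowla` at every Linnik-generic dilation, pointwise in `q`, with the bound of a plain table
of the same dimensions `(A/q) × (x/(Aq))`. `q = 1` is `TableChowla` itself. -/
def GenericAffineTable : Prop :=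
  ∀ c : ℤ, c ≠ 0 → ∀ δ : ℝ, 0 < δ → δ ≤ 1 / 12 → ∀ C : ℝ, 0 < C → ∃ K' : ℝ, 0 < K' ∧
    ∃ x₀ : ℝ, ∀ x : ℝ, x₀ ≤ x → ∀ A : ℝ, x ^ δ ≤ A → A ≤ x ^ (1 / 3 + δ) →
      ∀ q : ℕ, 1 ≤ q → (q : ℝ) ≤ x ^ (δ / 2) → LinnikGeneric q x K' → ∀ u v : ℕ,
        blockMoment c x A q u v ≤ x ^ 2 / ((q : ℝ) ^ 4 * Real.log x ^ (C + 1))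

/-- The card's assembly for the crux (all three hypotheses explicit; the log-free zero-density
count of non-generic conductors and Siegel's theorem enter the proof of this implication). -/
def CardOneAssembly : Prop :=
  GramFourthMomentMonotone → HarmonicQuarantine → TableChowla → GenericAffineTable →
    DilatedTableChowla

/-! ## Card `rough-rows-descent` -/

/-- FIRST LEMMA (D): the exact decimation identity of shifted multiplication tables,
`M^{(A)}[a, p·b] = M^{(pA)}[p·a, b]`, equivalently `M^{(A)}[p·a₁, b] = M^{(A/p)}[a₁, p·b]`: a row
divisible by `p` at scale `A` IS a `p`-decimated row of the table at scale `A/p` (same shift `c`,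
same `x`). -/
theorem decimation_entry (a b p : ℕ) (c : ℤ) :
    liouville (Int.toNat ((a : ℤ) * ((p * b : ℕ) : ℤ) + c)) =
      liouville (Int.toNat (((p * a : ℕ) : ℤ) * (b : ℤ) + c)) := by
  congr 2; push_cast; ring

/-- The block moment with an extra divisibility condition `p ∣ a, p ∣ a'` on the rows. -/
noncomputable def blockMomentRowsDiv (c : ℤ) (x A : ℝ) (q u v p : ℕ) : ℝ :=
  ∑ a ∈ ((Finset.Ioc ⌊A⌋₊ ⌊2 * A⌋₊).filter (fun a : ℕ => a ≡ u [MOD q])).filter (fun a => p ∣ a),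
    ∑ a' ∈ ((Finset.Ioc ⌊A⌋₊ ⌊2 * A⌋₊).filter (fun a' : ℕ => a' ≡ u [MOD q])).filter (fun a' => p ∣ a'),
      (∑ b ∈ (Finset.Icc 1 ⌊x / A⌋₊).filter (fun b : ℕ => b ≡ v [MOD q]),
        (liouville (Int.toNat ((a : ℤ) * b + c)) : ℝ) *
          (liouville (Int.toNat ((a' : ℤ) * b + c)) : ℝ)) ^ 2

/-- SMOOTH ROWS DESCEND (provable from `decimation_entry` + (P)): the `p`-divisible rows of the
block `(q;u,v)` at scale `A` form, after `a = p a₁`, `b ↦ p b`, a sub-block of the block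
`(q; u', p v)` at scale `A/p` (`p u' ≡ u (mod q)`, `p ∤ q`) with the extra COLUMN condition `p ∣ b'`;
dropping that condition can only increase the Gram fourth moment. Same dilation `q`, same trivial
size `x²/q⁴`, same target — no loss. (For `A ∈ ℕ`, `p ∣ A` the floors match exactly; in general up
to boundary rows, which the card's statement absorbs.) -/
def SmoothRowsDescend : Prop :=
  ∀ (c : ℤ) (x : ℝ) (A q u u' v p : ℕ), Nat.Prime p → Nat.Coprime p q → p * u' ≡ u [MOD q] →
    p ∣ A → blockMomentRowsDiv c x A q u v p ≤ blockMoment c x (A / p : ℕ) q u' (p * v)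

/-- (P') Splitting the rows into `k` parts costs a factor `k`:
`F(S₁ ⊔ S₂) ≤ 2 (F(S₁) + F(S₂))` (Frobenius: `‖G‖² = ‖G₁₁‖² + ‖G₂₂‖² + 2‖G₁₂‖²` and
`‖G₁₂‖²_F = tr(M₁ᵀM₁ M₂ᵀM₂) ≤ ‖M₁ᵀM₁‖_F ‖M₂ᵀM₂‖_F`). -/
def RowSplitBound : Prop :=
  ∀ (f : ℕ → ℕ → ℝ) (S₁ S₂ T : Finset ℕ), Disjoint S₁ S₂ →
    (∑ a ∈ S₁ ∪ S₂, ∑ a' ∈ S₁ ∪ S₂, (∑ b ∈ T, f a b * f a' b) ^ 2) ≤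
      2 * ((∑ a ∈ S₁, ∑ a' ∈ S₁, (∑ b ∈ T, f a b * f a' b) ^ 2) +
        (∑ a ∈ S₂, ∑ a' ∈ S₂, (∑ b ∈ T, f a b * f a' b) ^ 2))

/-- The ROUGH-ROW normal form of the crux (the card's transfer `C⁺`, to be combined with
`GenericAffineTable` of the first card): the crux's inequality with both row indices restricted to
integers all of whose prime factors `≤ y_A := min((log x)^K, A/x^δ)` divide `q` (for `q = 1`:
`y_A`-rough rows), for every `K` — the threshold `A/x^δ` records that a row can only descend to a
scale `A/p ≥ x^δ` inside the window (at the bottom sliver `A < 2x^δ` nothing is removed). Rows with a small prime `p ∣ a`, `p ∤ q` are the ones that descend losslessly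
(`SmoothRowsDescend`); a small `p ∣ a` with `p ∣ q` forces `p ∣ u` and the block is a rescaled copy,
kept in the normal form. -/
def RoughRowCrux : Prop :=
  ∀ c : ℤ, c ≠ 0 → ∀ δ : ℝ, 0 < δ → δ ≤ 1 / 12 → ∀ K : ℝ, 0 < K → ∀ C : ℝ, 0 < C →
    ∃ x₀ : ℝ, ∀ x : ℝ, x₀ ≤ x → ∀ A : ℝ, x ^ δ ≤ A → A ≤ x ^ (1 / 3 + δ) → ∀ u v : ℕ → ℕ,
      (∑ q ∈ Finset.Icc 1 ⌊x ^ (δ / 2)⌋₊, (q : ℝ) ^ 3 *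
        ∑ a ∈ ((Finset.Ioc ⌊A⌋₊ ⌊2 * A⌋₊).filter (fun a : ℕ => a ≡ u q [MOD q])).filter
            (fun a => Nat.gcd a (primorial (min ⌊Real.log x ^ K⌋₊ ⌊A / x ^ δ⌋₊)) ∣ q),
          ∑ a' ∈ ((Finset.Ioc ⌊A⌋₊ ⌊2 * A⌋₊).filter (fun a' : ℕ => a' ≡ u q [MOD q])).filter
              (fun a' => Nat.gcd a' (primorial (min ⌊Real.log x ^ K⌋₊ ⌊A / x ^ δ⌋₊)) ∣ q),
            (∑ b ∈ (Finset.Icc 1 ⌊x / A⌋₊).filter (fun b : ℕ => b ≡ v q [MOD q]),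
              (liouville (Int.toNat ((a : ℤ) * b + c)) : ℝ) *
                (liouville (Int.toNat ((a' : ℤ) * b + c)) : ℝ)) ^ 2)
        ≤ x ^ 2 / Real.log x ^ C

/-- The card's descent claim (induction on scales inside the window; the bottom sliver
`A < x^δ (log x)^K` is where the descent cannot push smooth rows further down and the full
statement is used at the smaller exponent `δ/2` for the undilated rows — see the card). -/
def CardTwoAssembly : Prop :=
  GramFourthMomentMonotone → RowSplitBound → SmoothRowsDescend → RoughRowCrux → DilatedTableChowla

end Summit.Parity.GeneralizedHardyLittlewood.Cruxes.DilatedTableChowla.Sketch
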